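import Summits.AtomisticToContinuum.FouriersLaw.Theorems.BondHeatUncertaintyExtensiveSnapshotIrreversibilityEnergyWindowHessianSplit

/-!
# Crux `ExtensiveSnapshotIrreversibility` (stmt-AtomisticToContinuum-9121): the far-side Duhamel split beneath S3, part B — the compact test class (G12*ᶜᶜ) for the far leaf, and `(G12*ᶜᶜ) → (G2*)`

Cell decomp-a2c, lens «grading / quantitative ladder», generation 82, part B of the node
«HessianSplit» (parts A and main: `…EnergyWindowHessianSplitA`, `…EnergyWindowHessianSplit`).

CONTENTS.  The far leaf (G2*) `PerturbedKernelHessianIBP` quantifies over GLOBAL `C²` observables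
`G` with `|G| ≤ M e^{θ₁H}` (the glue feeds it `G = P⁰_{1−s} h`, for which no derivative bounds are
available).  The form a fixed-time Malliavin / skeleton integration by parts naturally PRODUCES is
the bound for COMPACTLY SUPPORTED `C²` observables, at first AND second order:
(G12*ᶜᶜ) `PerturbedKernelHessianIBPCompact` (§1; time `s ∈ [½, 1]`, NO rate).  §3 proves
★ `perturbedKernelHessianIBP_of_compact : (G12*ᶜᶜ) → (G2*)` by smooth truncation `G_R = χ_R G`
with the scaled cutoffs `χ_R` of part R (`ewCutoff`; `|∂_{p_b}χ_R| ≤ K/R`, and §2: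
`|∂²_{p_b}χ_R| ≤ K₂/R²`) and the identity
`χ_R ∂²_b G = ∂²_b(χ_R G) − 2 ∂_b(G ∂_bχ_R) + G ∂²_bχ_R`:
the first term is the second-order clause of (G12*ᶜᶜ) for `χ_R G`, the second the FIRST-order
clause for the compactly supported `G ∂_bχ_R` (envelope `(MK/R) e^{θ₁H}`), the third is
`≤ (MK₂/R²) ∫ e^{θ₁H} dP^δ_s(z,·) < ∞` (CEHR (3.4), after shrinking `δ₀` so that
`θ₁ < 1/(T + δ₀/2)`); `R → ∞` by dominated convergence when `∂²_bG ∈ L¹(P^δ_s(z,·))`, and the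
Bochner integral is `0` otherwise.  §4: the junctions with (G12*ᶜᶜ) in place of (G2*):
★ `kernelTemperatureLipschitz_of_hessianSplitCompact : (Dˢ) → (G2) → (G12*ᶜᶜ) → S3` and
`snapshotKLUpperExpansion_of_atoms₈Hc`.  0 sorry; standard axioms.

References: N. Cuneo, J.-P. Eckmann, M. Hairer, L. Rey-Bellet, EJP 23 (2018) no. 55, §3 (3.4);
D. Nualart, The Malliavin Calculus and Related Topics (2006), Prop 2.1.4, §2.3.
-/

noncomputable section

namespace Summit.AtomisticToContinuum.FouriersLaw.Theorems.ExtensiveSnapshotIrreversibility.EnergyWindow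
open MeasureTheory ProbabilityTheory Filter Topology Real Set Metric
open scoped ENNReal NNReal ContDiff
open Literature.MathematicalPhysics.KineticTheory.HeatConduction

/-! ## 1. (G12*ᶜᶜ): fixed-time first- and second-order IBP against `P^δ_s(z,·)`, compact class -/

/-- **(G12*ᶜᶜ) `PerturbedKernelHessianIBPCompact`** (after (G2*) `PerturbedKernelHessianIBP`)[route leaf beneath (G2*), K_fix half of stmt-9121]:
for `0 < θ₁ < θ₂ < 1/T` there are `δ₀ > 0`, `C` with: for `|δ| < δ₀`, `s ∈ [½, 1]`, a bath site
`b`, `M ≥ 0` and every COMPACTLY SUPPORTED `G ∈ C²` with `|G| ≤ M e^{θ₁H}`, both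
`|∫ ∂_{p_b} G dP^δ_s(z,·)|` and `|∫ ∂_{p_b}∂_{p_b} G dP^δ_s(z,·)|` are `≤ C M e^{θ₂H(z)}`.
Fixed positive time: NO rate in `s`.  Truth sketch: the density `p^δ(s,z,·)` is smooth (CEHR
Prop 3.2) and the claim is the weighted `W^{2,1}` bound
`∫ e^{θ₁H(y)} (|∂_{y_b} p^δ| + |∂²_{y_b} p^δ|)(s,z,y) dy ≤ C e^{θ₂H(z)}`, i.e. moments of the first-
and second-order Skorokhod / skeleton IBP weights at time `s ≥ ½` (Malliavin matrix at a fixed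
time, Lyapunov control `e^{εH}`), Hölder with CEHR (3.4).  [NEW · WEAKER · ATTACKABLE-L]
(after CuneoEckmannHairerReyBellet2018, §3 eq. (3.4), Prop. 3.2) [route leaf · named hypothesis of this cell, NOT filed as a literature fact] -/
def PerturbedKernelHessianIBPCompact : Prop :=
  ∀ ω₂ lam β γ : ℝ, 0 < ω₂ → 0 < lam → 0 < β → 0 < γ →
    ∀ T : ℝ, 0 < T → ∀ (N : ℕ) (hN : 2 ≤ N), ∀ θ₁ θ₂ : ℝ, 0 < θ₁ → θ₁ < θ₂ → θ₂ < 1 / T →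
      ∃ δ₀ C : ℝ, 0 < δ₀ ∧ ∀ δ : ℝ, |δ| < δ₀ →
        ∀ s : ℝ, 1 / 2 ≤ s → s ≤ 1 → ∀ b : Fin N, (b = leftBath N hN ∨ b = rightBath N hN) →
          ∀ M : ℝ, 0 ≤ M → ∀ G : PhaseSpace N → ℝ, ContDiff ℝ 2 G → HasCompactSupport G →
            (∀ w, |G w| ≤ M * Real.exp (θ₁ * (pinnedChain ω₂ lam β γ).hamiltonian N w)) →
            ∀ z : PhaseSpace N,
              |∫ w, partialP b G w ∂(pertKernel ω₂ lam β γ T δ N s z)| ≤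
                  C * M * Real.exp (θ₂ * (pinnedChain ω₂ lam β γ).hamiltonian N z) ∧
                |∫ w, partialP b (partialP b G) w ∂(pertKernel ω₂ lam β γ T δ N s z)| ≤
                  C * M * Real.exp (θ₂ * (pinnedChain ω₂ lam β γ).hamiltonian N z)

/-! ## 2. Calculus: sum rule, and the Hessian of the scaled cutoff `|∂²_{p_b} χ_R| ≤ K₂/R²` -/

section Calculus

variable {N : ℕ}

/-- Sum rule `∂_{p_b}(f + g) = ∂_{p_b} f + ∂_{p_b} g`, pointwise `fun`-form. [folklore] -/
theorem partialP_fun_add (b : Fin N) {f g : PhaseSpace N → ℝ} {w : PhaseSpace N}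
    (hf : DifferentiableAt ℝ f w) (hg : DifferentiableAt ℝ g w) :
    partialP b (fun y => f y + g y) w = partialP b f w + partialP b g w := by
  have hfg : DifferentiableAt ℝ (fun y => f y + g y) w := hf.add hg
  rw [partialP_eq_fderiv_apply b hfg, partialP_eq_fderiv_apply b hf,
    partialP_eq_fderiv_apply b hg, fderiv_fun_add hf hg]
  rfl

/-- Chain rule through the scaling: `D(φ(·/R))(w)v = R⁻¹ Dφ(w/R)v`. [folklore] -/
theorem fderiv_comp_ewScale_apply {φ : PhaseSpace N → ℝ} (hφ : Differentiable ℝ φ) (R : ℝ)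
    (w v : PhaseSpace N) :
    fderiv ℝ (fun w => φ (ewScale N R w)) w v = R⁻¹ * fderiv ℝ φ (ewScale N R w) v := by
  have hc : (fun w => φ (ewScale N R w)) = φ ∘ (ewScale N R) := rfl
  rw [hc, fderiv_comp w (hφ _) (ewScale N R).differentiableAt, (ewScale N R).fderiv]
  simp only [ContinuousLinearMap.coe_comp, Function.comp_apply, ewScale_apply, map_smul,
    smul_eq_mul]

/-- `∂_{p_b} χ_R = R⁻¹ φ_b(·/R)` with `φ_b = Dχ(·)(0, e_b)`. [folklore] -/
theorem partialP_ewCutoff_eq (b : Fin N) (R : ℝ) :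
    partialP b (ewCutoff N R) = fun w =>
      R⁻¹ * fderiv ℝ (ewBump N) (ewScale N R w) ((0 : Fin N → ℝ), Pi.single b 1) := by
  funext w
  rw [partialP_eq_fderiv_apply b (((ewCutoff_contDiff (n := 1) R).differentiable (by simp)) w),
    fderiv_ewCutoff_apply]

/-- A uniform bound on a second directional derivative of the profile (continuous, compactly
supported). [folklore] -/
theorem exists_bound_fderiv_fderiv_ewBump (N : ℕ) (v : PhaseSpace N) :
    ∃ K : ℝ, 0 ≤ K ∧ ∀ u : PhaseSpace N,
      |fderiv ℝ (fun u => fderiv ℝ (ewBump N) u v) u v| ≤ K := by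
  have hφ : ContDiff ℝ 1 fun u => fderiv ℝ (ewBump N) u v :=
    (((ewBump N).contDiff (n := 2)).fderiv_right (m := 1) (by norm_num)).clm_apply contDiff_const
  have hφK : HasCompactSupport fun u => fderiv ℝ (ewBump N) u v :=
    (ewBump N).hasCompactSupport.fderiv_apply (𝕜 := ℝ) v
  obtain ⟨K, hK⟩ := (hφ.continuous_fderiv one_ne_zero).bounded_above_of_compact_support
    (hφK.fderiv (𝕜 := ℝ))
  refine ⟨max K 0 * ‖v‖, by positivity, fun u => ?_⟩
  rw [← Real.norm_eq_abs]
  exact ((fderiv ℝ (fun u => fderiv ℝ (ewBump N) u v) u).le_opNorm v).trans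
    (mul_le_mul_of_nonneg_right ((hK u).trans (le_max_left _ _)) (norm_nonneg _))

/-- `|∂_{p_b}∂_{p_b} χ_R| ≤ K₂/R²`. [folklore] -/
theorem abs_partialP_partialP_ewCutoff_le {b : Fin N} {K : ℝ}
    (hK : ∀ u : PhaseSpace N, |fderiv ℝ (fun u => fderiv ℝ (ewBump N) u
      ((0 : Fin N → ℝ), Pi.single b 1)) u ((0 : Fin N → ℝ), Pi.single b 1)| ≤ K)
    {R : ℝ} (hR : 0 < R) (w : PhaseSpace N) :
    |partialP b (partialP b (ewCutoff N R)) w| ≤ K / R ^ 2 := by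
  set v : PhaseSpace N := ((0 : Fin N → ℝ), Pi.single b 1) with hv
  have hφd : Differentiable ℝ fun u => fderiv ℝ (ewBump N) u v :=
    ((((ewBump N).contDiff (n := 2)).fderiv_right (m := 1) (by norm_num)).clm_apply
      contDiff_const).differentiable one_ne_zero
  have hcd : DifferentiableAt ℝ (fun w => fderiv ℝ (ewBump N) (ewScale N R w) v) w :=
    (hφd.comp (ewScale N R).differentiable) w
  rw [partialP_ewCutoff_eq b R, partialP_const_mul, partialP_eq_fderiv_apply b hcd,
    fderiv_comp_ewScale_apply hφd, abs_mul, abs_mul, abs_inv, abs_of_pos hR]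
  calc R⁻¹ * (R⁻¹ * |fderiv ℝ (fun u => fderiv ℝ (ewBump N) u v) (ewScale N R w) v|)
      ≤ R⁻¹ * (R⁻¹ * K) := by gcongr; exact hK _
    _ = K / R ^ 2 := by ring

end Calculus

/-! ## 3. `(G12*ᶜᶜ) → (G2*)`: smooth truncation of the observable, second order -/

/-- ★ **`(G12*ᶜᶜ) → (G2*)`.** For `G ∈ C²` with `|G| ≤ Me^{θ₁H}` and the truncations `χ_R G`:
`∫ χ_R ∂²_b G dP = ∫ ∂²_b(χ_R G) dP − 2∫ ∂_b(G ∂_bχ_R) dP + ∫ G ∂²_bχ_R dP`; the first term is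
bounded by the second-order clause of (G12*ᶜᶜ), the second by the first-order clause applied to
the compactly supported `G ∂_bχ_R` (`|G ∂_bχ_R| ≤ (MK/R) e^{θ₁H}`), the third by
`(MK₂/R²) ∫ e^{θ₁H} dP^δ_s(z,·) < ∞` (CEHR (3.4), after shrinking `δ₀` so that
`θ₁ < 1/(T + δ₀/2)`); `R → ∞` by dominated convergence when `∂²_b G ∈ L¹(P^δ_s(z,·))`, and the
Bochner integral is `0` otherwise.  No bound on `∂_b G` is needed.
[cite: CuneoEckmannHairerReyBellet2018, §3 eq. (3.4)] -/
theorem perturbedKernelHessianIBP_of_compact (hI : PerturbedKernelHessianIBPCompact) :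
    PerturbedKernelHessianIBP := by
  intro ω₂ lam β γ hω hl hβ hγ T hT N hN θ₁ θ₂ hθ₁ hθ₁₂ hθ₂
  obtain ⟨δ₀, C, hδ₀, hmain⟩ := hI ω₂ lam β γ hω hl hβ hγ T hT N hN θ₁ θ₂ hθ₁ hθ₁₂ hθ₂
  have hN0 : 0 < N := by omega
  have hθ₁T : θ₁ < 1 / T := hθ₁₂.trans hθ₂
  have hTθ : T < 1 / θ₁ := by
    rw [lt_div_iff₀ hθ₁]
    have := (lt_div_iff₀ hT).1 hθ₁T
    linarith [mul_comm θ₁ T]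
  refine ⟨min δ₀ (min T (1 / θ₁ - T)), max C 0, lt_min hδ₀ (lt_min hT (by linarith)),
    fun δ hδ s hs0 hs1 b hb M hM G hGC hGM z => ?_⟩
  have hδ0 : |δ| < δ₀ := hδ.trans_le (min_le_left _ _)
  have hδT : |δ| < T := (hδ.trans_le (min_le_right _ _)).trans_le (min_le_left _ _)
  have hδθ : |δ| < 1 / θ₁ - T := (hδ.trans_le (min_le_right _ _)).trans_le (min_le_right _ _)
  have hδabs := abs_lt.1 hδT
  have hδabs' := abs_lt.1 hδθ
  have hL : 0 < T + δ / 2 := by linarith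
  have hR : 0 < T - δ / 2 := by linarith
  have hmaxpos : 0 < max (T + δ / 2) (T - δ / 2) := lt_max_of_lt_left hL
  have hmaxlt : max (T + δ / 2) (T - δ / 2) < 1 / θ₁ := max_lt (by linarith) (by linarith)
  have hθδ : θ₁ < 1 / max (T + δ / 2) (T - δ / 2) := by
    rw [lt_div_iff₀ hmaxpos]
    have := (lt_div_iff₀ hθ₁).1 hmaxlt
    linarith [mul_comm θ₁ (max (T + δ / 2) (T - δ / 2))]
  set Hm := (pinnedChain ω₂ lam β γ).hamiltonian N with hHm
  set μ : Measure (PhaseSpace N) := pertKernel ω₂ lam β γ T δ N s z with hμ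
  set B : ℝ := max C 0 * M * Real.exp (θ₂ * Hm z) with hB
  have hB0 : 0 ≤ B := by positivity
  by_cases hint : Integrable (partialP b (partialP b G)) μ
  swap
  · rw [integral_undef hint, abs_zero]
    exact hB0
  -- `P^δ_s(z,·)` is a probability measure
  haveI : IsProbabilityMeasure μ := by
    haveI := pinnedChain_isMarkovKernel_transitionKernel hω hl.le hβ.le hγ.le N (T + δ / 2)
      (T - δ / 2) s.toNNReal
    rw [hμ]
    unfold pertKernel
    infer_instance
  -- the weight `e^{θ₁H}` is integrable for `P^δ_s(z,·)` (CEHR (3.4))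
  set wt : PhaseSpace N → ℝ := fun y => Real.exp (θ₁ * Hm y) with hwt
  have hwm : Measurable wt :=
    (continuous_const.mul (pinnedChain_continuous_hamiltonian ω₂ lam β γ N)).rexp.measurable
  have hwle : ∀ y, |wt y| ≤ 1 * Real.exp (θ₁ * Hm y) := fun y => by
    rw [one_mul, hwt, abs_of_pos (Real.exp_pos _)]
  have hwi : Integrable wt μ :=
    (integrable_and_abs_integral_transitionKernel_le hω hl hβ hγ hN0 hL hR hθ₁ hθδ s.toNNReal z
      zero_le_one hwm hwle).1
  set I : ℝ := ∫ y, wt y ∂μ with hI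
  have hI0 : 0 ≤ I := integral_nonneg fun y => (Real.exp_pos _).le
  -- derivative data of `G` and of the profile
  have hGd : Differentiable ℝ G := hGC.differentiable (by norm_num)
  have hG'C : ContDiff ℝ 1 (partialP b G) := contDiff_one_partialP_of_contDiff_two b hGC
  have hG'd : Differentiable ℝ (partialP b G) := hG'C.differentiable one_ne_zero
  have hpgc : Continuous (partialP b (partialP b G)) := continuous_partialP_of_contDiff b hG'C
  set v : PhaseSpace N := ((0 : Fin N → ℝ), Pi.single b 1) with hv
  obtain ⟨K, hK0, hK⟩ := exists_bound_fderiv_ewBump N v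
  obtain ⟨K₂, hK₂0, hK₂⟩ := exists_bound_fderiv_fderiv_ewBump N v
  -- the truncations `G_n = χ_{n+1} G`
  have key : ∀ n : ℕ,
      |∫ w, ewCutoff N ((n : ℝ) + 1) w * partialP b (partialP b G) w ∂μ| ≤
        B + (2 * (B * K) + K₂ * M * I) * (1 / ((n : ℝ) + 1)) := by
    intro n
    have hRp : (0 : ℝ) < (n : ℝ) + 1 := by positivity
    set χ : PhaseSpace N → ℝ := ewCutoff N ((n : ℝ) + 1) with hχ
    have hχC : ContDiff ℝ 2 χ := ewCutoff_contDiff _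
    have hχC3 : ContDiff ℝ 3 χ := ewCutoff_contDiff _
    have hχd : Differentiable ℝ χ := hχC.differentiable (by norm_num)
    have hχK : HasCompactSupport χ := hasCompactSupport_ewCutoff hRp
    have hχ'C : ContDiff ℝ 2 (partialP b χ) := contDiff_partialP hχC3 (by norm_num) b
    have hχ'd : Differentiable ℝ (partialP b χ) := hχ'C.differentiable (by norm_num)
    have hχ'K : HasCompactSupport (partialP b χ) := hasCompactSupport_partialP hχd hχK b
    have hχ''C : ContDiff ℝ 1 (partialP b (partialP b χ)) :=
      contDiff_one_partialP_of_contDiff_two b hχ'C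
    have hχ''K : HasCompactSupport (partialP b (partialP b χ)) :=
      hasCompactSupport_partialP hχ'd hχ'K b
    have hχb : ∀ w, |partialP b χ w| ≤ K / ((n : ℝ) + 1) := fun w =>
      abs_partialP_ewCutoff_le hK hRp w
    have hχbb : ∀ w, |partialP b (partialP b χ) w| ≤ K₂ / ((n : ℝ) + 1) ^ 2 := fun w =>
      abs_partialP_partialP_ewCutoff_le hK₂ hRp w
    -- (1) the truncated observable `χ G` and the second-order clause for it
    have hGnC : ContDiff ℝ 2 fun y => χ y * G y := hχC.mul hGC
    have hGnK : HasCompactSupport fun y => χ y * G y := hχK.mul_right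
    have hGnM : ∀ w, |χ w * G w| ≤ M * Real.exp (θ₁ * Hm w) := fun w => by
      rw [abs_mul]
      exact (mul_le_of_le_one_left (abs_nonneg _) (abs_ewCutoff_le_one _ w)).trans (hGM w)
    have hT1 : |∫ w, partialP b (partialP b fun y => χ y * G y) w ∂μ| ≤ B :=
      (hmain δ hδ0 s hs0 hs1 b hb M hM _ hGnC hGnK hGnM z).2.trans
        (mul_le_mul_of_nonneg_right (mul_le_mul_of_nonneg_right (le_max_left C 0) hM)
          (Real.exp_pos _).le)
    -- (2) the compactly supported `G ∂χ` and the first-order clause for it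
    have hFnC : ContDiff ℝ 2 fun y => G y * partialP b χ y := hGC.mul hχ'C
    have hFnK : HasCompactSupport fun y => G y * partialP b χ y := hχ'K.mul_left
    have hMK : 0 ≤ M * (K / ((n : ℝ) + 1)) := by positivity
    have hFnM : ∀ w, |G w * partialP b χ w| ≤
        M * (K / ((n : ℝ) + 1)) * Real.exp (θ₁ * Hm w) := fun w => by
      rw [abs_mul]
      calc |G w| * |partialP b χ w|
          ≤ M * Real.exp (θ₁ * Hm w) * (K / ((n : ℝ) + 1)) :=
            mul_le_mul (hGM w) (hχb w) (abs_nonneg _) (by positivity)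
        _ = M * (K / ((n : ℝ) + 1)) * Real.exp (θ₁ * Hm w) := by ring
    have hT2 : |∫ w, partialP b (fun y => G y * partialP b χ y) w ∂μ| ≤
        B * K * (1 / ((n : ℝ) + 1)) := by
      refine (hmain δ hδ0 s hs0 hs1 b hb _ hMK _ hFnC hFnK hFnM z).1.trans ?_
      calc C * (M * (K / ((n : ℝ) + 1))) * Real.exp (θ₂ * Hm z)
          ≤ max C 0 * (M * (K / ((n : ℝ) + 1))) * Real.exp (θ₂ * Hm z) :=
            mul_le_mul_of_nonneg_right (mul_le_mul_of_nonneg_right (le_max_left C 0) hMK)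
              (Real.exp_pos _).le
        _ = B * K * (1 / ((n : ℝ) + 1)) := by rw [hB]; ring
    -- (3) the term `G ∂²χ`
    have hdom3 : ∀ w, ‖G w * partialP b (partialP b χ) w‖ ≤
        K₂ / ((n : ℝ) + 1) ^ 2 * M * wt w := fun w => by
      rw [Real.norm_eq_abs, abs_mul]
      calc |G w| * |partialP b (partialP b χ) w|
          ≤ M * Real.exp (θ₁ * Hm w) * (K₂ / ((n : ℝ) + 1) ^ 2) :=
            mul_le_mul (hGM w) (hχbb w) (abs_nonneg _) (by positivity)
        _ = K₂ / ((n : ℝ) + 1) ^ 2 * M * wt w := by rw [hwt]; ring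
    have hi3 : Integrable (fun w => G w * partialP b (partialP b χ) w) μ :=
      Integrable.mono' (hwi.const_mul (K₂ / ((n : ℝ) + 1) ^ 2 * M))
        (hGC.continuous.mul hχ''C.continuous).aestronglyMeasurable (ae_of_all _ hdom3)
    have hT3 : |∫ w, G w * partialP b (partialP b χ) w ∂μ| ≤
        K₂ / ((n : ℝ) + 1) ^ 2 * M * I := by
      rw [← Real.norm_eq_abs]
      refine (norm_integral_le_of_norm_le (hwi.const_mul _) (ae_of_all _ hdom3)).trans_eq ?_
      rw [integral_const_mul]
    -- (4) the identity `χ ∂²G = ∂²(χG) − 2 ∂(G ∂χ) + G ∂²χ`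
    have hid : (fun w => χ w * partialP b (partialP b G) w) = fun w =>
        (partialP b (partialP b fun y => χ y * G y) w -
            2 * partialP b (fun y => G y * partialP b χ y) w) +
          G w * partialP b (partialP b χ) w := by
      funext w
      have e1 : partialP b (fun y => χ y * G y) = fun y =>
          χ y * partialP b G y + G y * partialP b χ y :=
        funext fun y => partialP_fun_mul b (hχd y) (hGd y)
      have e2 : partialP b (partialP b fun y => χ y * G y) w =
          (χ w * partialP b (partialP b G) w + partialP b G w * partialP b χ w) +
            (G w * partialP b (partialP b χ) w + partialP b χ w * partialP b G w) := by
        have d1 : DifferentiableAt ℝ (fun y => χ y * partialP b G y) w := (hχd w).mul (hG'd w)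
        have d2 : DifferentiableAt ℝ (fun y => G y * partialP b χ y) w := (hGd w).mul (hχ'd w)
        rw [e1, partialP_fun_add b d1 d2, partialP_fun_mul b (hχd w) (hG'd w),
          partialP_fun_mul b (hGd w) (hχ'd w)]
      have e3 : partialP b (fun y => G y * partialP b χ y) w =
          G w * partialP b (partialP b χ) w + partialP b χ w * partialP b G w :=
        partialP_fun_mul b (hGd w) (hχ'd w)
      rw [e2, e3]
      ring
    -- integrability of the three compactly supported continuous pieces
    have hi1 : Integrable (fun w => partialP b (partialP b fun y => χ y * G y) w) μ :=
      (continuous_partialP_of_contDiff b (contDiff_one_partialP_of_contDiff_two b hGnC))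
        |>.integrable_of_hasCompactSupport
        (hasCompactSupport_partialP ((contDiff_one_partialP_of_contDiff_two b hGnC)
          |>.differentiable one_ne_zero) (hasCompactSupport_partialP
            (hGnC.differentiable (by norm_num)) hGnK b) b)
    have hi2 : Integrable (fun w => partialP b (fun y => G y * partialP b χ y) w) μ :=
      (contDiff_one_partialP_of_contDiff_two b hFnC).continuous.integrable_of_hasCompactSupport
        (hasCompactSupport_partialP (hFnC.differentiable (by norm_num)) hFnK b)
    have hi12 : Integrable (fun w => partialP b (partialP b fun y => χ y * G y) w -
        2 * partialP b (fun y => G y * partialP b χ y) w) μ := hi1.sub (hi2.const_mul 2)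
    have hi2' : Integrable (fun w => 2 * partialP b (fun y => G y * partialP b χ y) w) μ :=
      hi2.const_mul 2
    have hsplit : ∫ w, χ w * partialP b (partialP b G) w ∂μ =
        (∫ w, partialP b (partialP b fun y => χ y * G y) w ∂μ) -
            2 * (∫ w, partialP b (fun y => G y * partialP b χ y) w ∂μ) +
          ∫ w, G w * partialP b (partialP b χ) w ∂μ := by
      rw [hid, integral_add hi12 hi3, integral_sub hi1 hi2', integral_const_mul]
    rw [hsplit]
    have hsq : K₂ / ((n : ℝ) + 1) ^ 2 * M * I ≤ K₂ / ((n : ℝ) + 1) * M * I :=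
      mul_le_mul_of_nonneg_right (mul_le_mul_of_nonneg_right
        (div_le_div_of_nonneg_left hK₂0 hRp (by nlinarith)) hM) hI0
    calc |(∫ w, partialP b (partialP b fun y => χ y * G y) w ∂μ) -
            2 * (∫ w, partialP b (fun y => G y * partialP b χ y) w ∂μ) +
          ∫ w, G w * partialP b (partialP b χ) w ∂μ|
        ≤ |(∫ w, partialP b (partialP b fun y => χ y * G y) w ∂μ) -
            2 * (∫ w, partialP b (fun y => G y * partialP b χ y) w ∂μ)| +
          |∫ w, G w * partialP b (partialP b χ) w ∂μ| := abs_add_le _ _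
      _ ≤ (|∫ w, partialP b (partialP b fun y => χ y * G y) w ∂μ| +
            |2 * (∫ w, partialP b (fun y => G y * partialP b χ y) w ∂μ)|) +
          |∫ w, G w * partialP b (partialP b χ) w ∂μ| := by gcongr; exact abs_sub _ _
      _ ≤ (B + 2 * (B * K * (1 / ((n : ℝ) + 1)))) + K₂ / ((n : ℝ) + 1) ^ 2 * M * I := by
          rw [abs_mul, abs_two]
          gcongr
      _ ≤ (B + 2 * (B * K * (1 / ((n : ℝ) + 1)))) + K₂ / ((n : ℝ) + 1) * M * I := by
          gcongr 1
      _ = B + (2 * (B * K) + K₂ * M * I) * (1 / ((n : ℝ) + 1)) := by ring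
  -- `R → ∞`: dominated convergence for `χ_R ∂²_b G → ∂²_b G`
  have hlim : Tendsto (fun n : ℕ => ∫ w, ewCutoff N ((n : ℝ) + 1) w * partialP b (partialP b G) w
      ∂μ) atTop (𝓝 (∫ w, partialP b (partialP b G) w ∂μ)) := by
    refine tendsto_integral_of_dominated_convergence (fun w => ‖partialP b (partialP b G) w‖)
      (fun n => ((ewCutoff_contDiff (n := 1) _).continuous.mul hpgc).aestronglyMeasurable)
      hint.norm (fun n => ae_of_all _ fun w => ?_) (ae_of_all _ fun w => ?_)
    · rw [norm_mul, Real.norm_eq_abs (ewCutoff _ _ _)]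
      exact mul_le_of_le_one_left (norm_nonneg _) (abs_ewCutoff_le_one _ w)
    · refine tendsto_const_nhds.congr' ?_
      filter_upwards [Filter.eventually_ge_atTop ⌈‖w‖⌉₊] with n hn
      rw [ewCutoff_eq_one (by positivity) ?_, one_mul]
      calc ‖w‖ ≤ (⌈‖w‖⌉₊ : ℝ) := Nat.le_ceil _
        _ ≤ (n : ℝ) := by exact_mod_cast hn
        _ ≤ (n : ℝ) + 1 := by linarith
  have hlim' : Tendsto (fun n : ℕ => B + (2 * (B * K) + K₂ * M * I) * (1 / ((n : ℝ) + 1))) atTop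
      (𝓝 (B + (2 * (B * K) + K₂ * M * I) * 0)) :=
    tendsto_const_nhds.add
      ((tendsto_one_div_add_atTop_nhds_zero_nat (𝕜 := ℝ)).const_mul _)
  have hle := le_of_tendsto_of_tendsto' hlim.abs hlim' key
  simpa using hle

/-! ## 4. The junctions with the compact class in place of (G2*) -/

/-- ★ **S3 from the far-side split with the compact far class**:
`(Dˢ) → (G2) → (G12*ᶜᶜ) → KernelTemperatureLipschitz`.
[cite: CuneoEckmannHairerReyBellet2018, §3 eq. (3.2), (3.4), Prop. 3.2] -/
theorem kernelTemperatureLipschitz_of_hessianSplitCompact (hD : KernelTemperatureDuhamelSmooth)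
    (hG : EqualTemperatureBathHessian) (hI : PerturbedKernelHessianIBPCompact) :
    KernelTemperatureLipschitz :=
  kernelTemperatureLipschitz_of_hessianSplit hD hG (perturbedKernelHessianIBP_of_compact hI)

/-- ★ **K_fix junction with the compact far class**: `SnapshotKLUpperExpansion` from
`A0 ∧ A2 ∧ (Dˢ) ∧ (G2) ∧ (G12*ᶜᶜ) ∧ A3p ∧ A4`.
[cite: CuneoEckmannHairerReyBellet2018, §3 eq. (3.2), (3.4), Thm 4.1] -/
theorem snapshotKLUpperExpansion_of_atoms₈Hc (h0 : NessGibbsReweighting)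
    (h2 : NessOddLogRatioBound) (hD : KernelTemperatureDuhamelSmooth)
    (hG : EqualTemperatureBathHessian) (hI : PerturbedKernelHessianIBPCompact)
    (h3p : NessFloorMeanValue) (h4 : NessLinearResponseL2) : SnapshotKLUpperExpansion :=
  snapshotKLUpperExpansion_of_atoms₈H h0 h2 hD hG (perturbedKernelHessianIBP_of_compact hI) h3p h4

end Summit.AtomisticToContinuum.FouriersLaw.Theorems.ExtensiveSnapshotIrreversibility.EnergyWindow

end
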